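import Literature.MathematicalPhysics.QuantumFieldTheory.Balaban1983to89.B13Lemma3WindowTerms
import Literature.MathematicalPhysics.QuantumFieldTheory.Balaban1983to89.B13CauchyDecay

/-!
# `Balaban1983to89.B13Lemma3WindowCauchy` — T. Bałaban, *Renormalization group approach to lattice gauge field theories.
II. Cluster expansions*, Commun. Math. Phys. **116** (1988) 1–22 [Balaban1988RG2Cluster]: on the two-scale window model,
the hypothesis «(2.26) FOR EVERY TERM» of Lemma 3 (`B13Lemma3WindowTerms.bound238_window_of_226`) and of the §2 chain
(`B13Lemma3WindowChain.deliverables_window_of_226`) REDUCED, by the iterated Cauchy estimate `B13CauchyDecay`, to: the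
(2.14)-form of the terms, separate analyticity in the parameters σ(Δ), τ(Y), and the Gaussian sup bound of (2.15)–(2.25)

statement-level skeleton of published theorems with citation tags; proofs where landed; nothing here is a claim about the Yang–Mills mass gap

PDF held: `paper:balaban1988-cmp116-rg-ii-cluster` (journal page = PDF page + 0); pp. 15–17 (quoted in `B13Term214`,
`B13CauchyDecay`, `B13Lemma3WindowTerms`).

CITATION HEADER (verbatim, p. 15 [PDF 15] and p. 17 [PDF 17]).  *"To get a bound for H(Z) we consider a term in the sum
over 𝐃, P. This term can be written in the following form:"* (2.14) = `Π_{Δ⊂Z∖Z′₀}∫₀¹ds(Δ)(1/2πi)∮dσ(Δ)/(σ(Δ) − s(Δ))²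
Π_{Y∈𝐃}∫₀¹dt(Y)(1/2πi)∮dτ(Y)/(τ(Y) − t(Y))² [three Gaussian lines]`; *"We consider it as an analytic function of (𝐔, 𝐉)
…, and of the complex parameters σ(Z), τ. … The first estimate is"* (2.15) = `|(2.14)| ≦ exp(−(κ₁ − 1)(LM)⁻⁴|Z∖Z′₀|)
Π_{Y∈𝐃}(2/|τ(Y)|) · [moduli / real parts of the three lines]`; p. 17: *"This ends the estimate of the expression (2.14).
Gathering together all the bounds we get"* (2.26) = `|(2.14)| ≦ exp(−(κ₁ − 1)(LM)⁻⁴|Z∖Z′₀|)[Π_{Y∈𝐃} 2E₀ε₁C₁α₄⁻¹M^q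
e^{C₂κ₁}e^{−(1−3δ)κd_k(Y)}] exp(−½γ₂(ε₁²/g_k²)|P|) exp O(1)α₅|Z|`; *"To get a bound for H(Z) we have to perform the
resummation of the terms (2.14) over 𝐃, P and Z₀. … To bound H(Z) we use the estimate (2.26) for terms of these sums"*.

WHAT IS REPRODUCED (unit `lit-balaban-r10` gen 7, B13 fold owner; SKELETON rows `B13.Eq2.26`, `B13.Eq2.15`, `B13.Eq2.14`,
`B13.Lem3` of `HOME/lit-balaban-r10/ROWS-B13.md`, HOME = `run/shared/lean/pub/lit-balaban/`; kind «model-instance joiner»,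
one theorem).  **`h226_of_cauchy`**: on the window model of `B13Lemma3Window` / `B13Lemma3WindowTerms` (terms `t = (𝐃, P)`
of `H(Z)`, weights `weight c L M Z a t = exp(−(κ₁−1)·#LM-cubes(Z∖Z′₀))·Π_{Y∈𝐃}(α₆ε₂e^{−(1−3δ)κd_k(Y)})·e^{−½a|P|}`), IF
every term `T Z t φ` is the generic term (2.14) `B13Term214.term214 r (lZ Z t) (lD t) (Ψ Z t φ) 0 0` — σ-parameters an
enumeration of the LM-cubes of `Z∖Z′₀`, τ-parameters an enumeration of `𝐃`, base points `s = 0`, `t = 0` — with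
`Ψ Z t φ` separately holomorphic in `σ` on an open `Uσ ⊇ {|σ| ≤ e^{κ₁}}` (`κ₁ ≥ 1`) and in `τ` on an open
`Uτ ⊇ {|τ| ≤ |τ(Y)|}`, `|τ(Y)| = (invTau c (d_k Y))⁻¹` ((2.18), `0 < invTau ≤ ½`), and the SUP BOUND
`‖Ψ Z t φ σ τ‖ ≤ e^{−½a|P|}·e^{a₅·#LM-cubes(Z)}` on the two closed polydiscs (the Gaussian estimate (2.15)–(2.25) of the
last three lines of (2.14) — BY ASSERTION in print, rows B13.Eq2.15–2.25; a hypothesis), THEN (2.26) holds for every term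
in the exact spelling of the hypothesis `h226` of `B13Lemma3WindowTerms.hrep_of_termwise` / `bound238_window_of_226` /
`B13Lemma3WindowChain.deliverables_window_of_226`: `‖T Z t φ‖ ≤ weight c L M Z a t · exp(a₅·#cells Z)`.  Proof =
`B13CauchyDecay.norm_term214_le_226` + `B13CauchyDecay.two_mul_invTau_eq` (`2/|τ(Y)| = α₆ε₂e^{−(1−3δ)κd_k(Y)}`, `α₆ ≠ 0`)
+ `|lZ| = #cells(Z∖Z′₀)`.

RELATED (not restated).  The same mechanism for (1.23) ⇒ (1.24) p. 7 is kernel-checked in `B13Sect1Arith` Part B (cell `pub-balaban`: the operator `cauchyOp` with explicit contours, `norm_cauchyOp_le` / `bound_124` by the length × sup inequality, per-cube factor `e^{κ₁}(e^{κ₁} − 1)⁻² ≤ e^{−(κ₁−1)}` = `cauchy_factor_le`); `B13CauchyDecay` is the form for the objects of record of (2.14) (`B13Term214.TopC` / `DopC` / `term214`, separate holomorphy, per-parameter radii, two domains, per-parameter factor `(R − 1)⁻¹`), which is what this joiner needs.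

HONEST SCOPE.  A pure joiner: nothing analytic is proved here beyond what `B13CauchyDecay` proves (the Cauchy factors);
the (2.14)-form of the terms, their separate analyticity and the Gaussian sup bound are hypotheses; the window model's
readings (free boundary, over-counted term set, endpoint reading of Z₀ — HOME GAPS G-B13-P12-01) are those of
`B13Lemma3WindowTerms`.  With this file the window-model §2 chain `deliverables_window_of_226` has, upstream of the
resummation, exactly these inputs left by assertion: (2.15)–(2.25) (the sup bound), the representation of H(Z) by
(2.14)-terms ((2.9)/(2.14)), the log Z^{(k)} half, (I.1.7), analyticity in (U, J), gauge invariance.  No `sorry`, no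
definition, no new named fact (D-0026).
-/

namespace Literature.MathematicalPhysics.QuantumFieldTheory.Balaban1983to89.B13Lemma3WindowCauchy

open Metric Set
open Literature.MathematicalPhysics.QuantumFieldTheory.Balaban1983to89
open Literature.MathematicalPhysics.QuantumFieldTheory.Balaban1983to89.B13ScaleTransfer (Pt collar closureIdx)
open Literature.MathematicalPhysics.QuantumFieldTheory.Balaban1983to89.TreeLengthCubeSystem (Dom sys Cell cellsOf)
open Literature.MathematicalPhysics.QuantumFieldTheory.Balaban1983to89.B13Lemma3Window (LBond TwoWindowStep)
open Literature.MathematicalPhysics.QuantumFieldTheory.Balaban1983to89.B13Lemma3WindowTerms (terms weight Z0)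
open Literature.MathematicalPhysics.QuantumFieldTheory.Balaban1983to89.B13Term214 (term214 SepHolOn)
open Literature.MathematicalPhysics.QuantumFieldTheory.Balaban1983to89.B13Bound143 (invTau)
open Literature.MathematicalPhysics.QuantumFieldTheory.Balaban1983to89.B13CauchyDecay
  (norm_term214_le_226 two_mul_invTau_eq)

noncomputable section

variable {d : ℕ}

open Classical in
/-- **(2.26) FOR EVERY TERM from the Cauchy mechanism + the Gaussian sup bound** (window model).  Suppose every term
`T Z t φ`, `t = (𝐃, P)`, of the activity `H(Z)` is realized as the generic term (2.14) `B13Term214.term214 r lZ lD Ψ 0 0`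
with σ-parameters `lZ Z t` = an enumeration of the LM-cubes of `Z∖Z′₀` (`cellsOf Bk1 (Z ∖ closureIdx L (collar Z₀))`,
as in `B13Lemma3WindowTerms.weight`) and τ-parameters `lD t` = an enumeration of `𝐃`, the underintegral expression
`Ψ Z t φ` being separately holomorphic in `σ` on an open `Uσ ⊇ {|σ| ≤ e^{κ₁}}` (`κ₁ ≥ 1`) and in `τ` on an open
`Uτ ⊇ {|τ| ≤ |τ(Y)|}` with the radii `|τ(Y)| = (invTau c (d_k Y))⁻¹` of (2.18) (`0 < invTau ≤ ½`), and bounded on the two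
closed polydiscs by the Gaussian estimate `exp(−½a|P|)·exp(a₅·#LM-cubes of Z)` of (2.15)–(2.25) (a hypothesis: rows
B13.Eq2.15–2.25).  Then (2.26) holds for every term in the spelling of `B13Lemma3WindowTerms.hrep_of_termwise` /
`bound238_window_of_226` (hypothesis `h226` there): `‖T Z t φ‖ ≤ weight c L M Z a t · exp(a₅·#cells Z)` — by
`B13CauchyDecay.norm_term214_le_226` and the identity `2·invTau c d = α₆·ε₂·e^{−(1−3δ)κd}` (`α₆ ≠ 0`).  So on the window
model the hypothesis «(2.26) per term» of Lemma 3 / of the §2 chain reduces to: the (2.14)-form of the terms, separate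
analyticity in the parameters, and the Gaussian sup bound. [cite: Balaban1988RG2Cluster, (2.14)–(2.15) p.15, (2.26) p.17] -/
theorem h226_of_cauchy (c : B13.Consts) (hκ₁ : 1 ≤ c.κ₁) (hα₆ : c.α₆ ≠ 0) {L M : ℕ} {Bk Bk1 : Finset (Pt d)}
    (W : TwoWindowStep Bk Bk1) (T : (Z : Dom Bk1) → Finset (Dom Bk) × Finset (LBond d) → W.Φ → ℂ) {a a₅ : ℝ}
    {Uσ Uτ : Set ℂ} (hUσ : IsOpen Uσ) (hUτ : IsOpen Uτ) (hUexp : closedBall (0 : ℂ) (Real.exp c.κ₁) ⊆ Uσ)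
    (hUtau : ∀ Y : Dom Bk, closedBall (0 : ℂ) ((invTau c ((sys Bk).dj Y))⁻¹) ⊆ Uτ)
    {r : ℝ} (hr : 0 < r) (hr' : r ≤ Real.exp c.κ₁ - 1)
    (hsubτ : ∀ s ∈ Set.uIcc (0 : ℝ) 1, closedBall (s : ℂ) r ⊆ Uτ)
    (hpos : ∀ Y : Dom Bk, 0 < invTau c ((sys Bk).dj Y)) (h2 : ∀ Y : Dom Bk, invTau c ((sys Bk).dj Y) ≤ 1 / 2)
    (lZ : Dom Bk1 → Finset (Dom Bk) × Finset (LBond d) → List (Cell Bk1))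
    (hlZ : ∀ Z t, (lZ Z t).Nodup ∧ (lZ Z t).toFinset = cellsOf Bk1 (Z.1 \ closureIdx L (collar (Z0 M t))))
    (lD : Finset (Dom Bk) × Finset (LBond d) → List (Dom Bk)) (hlD : ∀ t, (lD t).Nodup ∧ (lD t).toFinset = t.1)
    (Ψ : (Z : Dom Bk1) → Finset (Dom Bk) × Finset (LBond d) → W.Φ → (Cell Bk1 → ℂ) → (Dom Bk → ℂ) → ℂ)
    (hT : ∀ Z t φ, T Z t φ = term214 r (lZ Z t) (lD t) (Ψ Z t φ) 0 0)
    (hΨσ : ∀ Z t φ, φ ∈ W.sp2 Z → ∀ τ : Dom Bk → ℂ, (∀ j, τ j ∈ Uτ) → SepHolOn Uσ (fun σ => Ψ Z t φ σ τ))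
    (hΨτ : ∀ Z t φ, φ ∈ W.sp2 Z → ∀ σ : Cell Bk1 → ℂ, (∀ j, σ j ∈ Uσ) → SepHolOn Uτ (fun τ => Ψ Z t φ σ τ))
    (hK : ∀ Z t φ, φ ∈ W.sp2 Z → ∀ (σ : Cell Bk1 → ℂ) (τ : Dom Bk → ℂ), (∀ j, ‖σ j‖ ≤ Real.exp c.κ₁) →
      (∀ Y, ‖τ Y‖ ≤ (invTau c ((sys Bk).dj Y))⁻¹) →
      ‖Ψ Z t φ σ τ‖ ≤ Real.exp (-(a / 2 * (t.2.card : ℝ))) * Real.exp (a₅ * ((cellsOf Bk1 Z.1).card : ℝ))) :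
    ∀ (Z : Dom Bk1) (φ : W.Φ), φ ∈ W.sp2 Z → ∀ t ∈ terms L M Bk Z,
      ‖T Z t φ‖ ≤ weight c L M Z a t * Real.exp (a₅ * ((cellsOf Bk1 Z.1).card : ℝ)) := by
  intro Z φ hφ t _
  rw [hT Z t φ]
  have h := norm_term214_le_226 (ι := Cell Bk1) (F := ℂ) c hκ₁ (fun Y : Dom Bk => (sys Bk).dj Y) hUσ hUτ hUexp
    hUtau hr hr' hsubτ (hΨσ Z t φ hφ) (hΨτ Z t φ hφ) (hK Z t φ hφ) (hlZ Z t).1 (hlD t).1 hpos h2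
    (σ₀ := 0) (fun _ => by simp) (τ₀ := 0) (fun _ => by simp)
  have hlen : ((lZ Z t).length : ℝ) = ((cellsOf Bk1 (Z.1 \ closureIdx L (collar (Z0 M t)))).card : ℝ) := by
    rw [← List.toFinset_card_of_nodup (hlZ Z t).1, (hlZ Z t).2]
  rw [hlen, (hlD t).2] at h
  refine h.trans (le_of_eq ?_)
  simp only [weight, two_mul_invTau_eq c hα₆]
  ring_nf

end

end Literature.MathematicalPhysics.QuantumFieldTheory.Balaban1983to89.B13Lemma3WindowCauchy
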